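import Mathlib
import HarnessLib
import Summits.HubbardSuperconductivity.HubbardSuperconductivity.Theorems.KLProgrammeKLRegimeTwoPointLimitCooperResummationLipschitz
import Summits.HubbardSuperconductivity.HubbardSuperconductivity.Theorems.KLProgrammeKLRegimeTwoPointLimitCooperResummationSingleSlice

/-!
# Route `KLProgramme`, crux K3 — the Cooper resummation with COMPLEX rungs of large mass: Sherman–Morrison structure, row / weighted-column
# sums and the mass-uniform Lipschitz constant `36` under a SIGNED-MASS allowance (ENGINE child gen 4, stmt-HubbardSuperconductivity-19855,
# clause (E2-v8) at `1 ≤ n`; cell gate-hubbard-kl, seat hubbard-kl-k3c1-p1 g4, technique «composed-map remainder propagation»)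

Twin of `klcrf_structure` / `klcrf_lipschitz` (`…CooperResummationFlow` / `…Lipschitz`, child 1, REAL weights `w ≥ 0`) for the ENGINE's carrier: on
`TorusSite 2 L × F` the cumulative pair rungs `z : ι → ℂ` are frequency-resolved and complex (realness and near-positivity hold only after
the `ν ↦ −ν` aggregation and deep inside the pair class — BundleV12's (real)/(neg) inputs).  The increment identity of `…EngineLadderIncrement`
(p479984: `𝒞′_n − T_K = (1 − 𝒞′_n·D_{B′})·δI_n·(1 − D_{B′}·T_K)`) turns the (E2) remainder into the irreducible increment `δI_n` dressed by two
CUMULATIVE resolvents, whose row / weighted-column masses must be `O(1)` UNIFORMLY in the accumulated mass `u·Σ|z| ≍ c/U` — the repulsive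
sign does it (Sherman–Morrison), provided the signed-mass defect `𝔑 = Σ‖z‖ − Re Σ z` is small against the running value: `u·𝔑 ≤ 1/4`.

Content (finite carrier, pure linear algebra; nothing about the model): for `u ≥ 0`, `|𝒟| ≤ δ`, `Z = Σ‖z‖`, `Z·δ ≤ 1/3`, `u·(Z − Re Σz) ≤ 1/4`,
with `T = 1 + (u·J + 𝒟)·diag z` and `F = T⁻¹·(u·J + 𝒟)`:
**`klcrc_structure`** — `T` is a unit, every ROW sum of `T⁻¹` is `≤ 6`, and `F = c·J + 𝒟″` with ONE complex running value `c` (`= u/d`,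
`d = 1 + u⟨z, (1 + 𝒟 diag z)⁻¹𝟙⟩`, `Re d ≥ 3/4 + uZ/2`), `‖c‖ ≤ (4/3)u`, `‖c‖·Z ≤ 2`, `|𝒟″| ≤ 9δ`; **`klcrc_entry_le`** (`|F| ≤ (4/3)u + 9δ`),
**`klcrc_rowMass_le`** / **`klcrc_colMass_le`** (`Σ_a |F(x,a)|‖z_a‖ ≤ 5`, `Σ_b ‖z_b‖|F(b,y)| ≤ 5` — the RESUMMED products `u·W/(1+uW)`-type,
not the crude `u·Z`), and **`klcrc_lipschitz`**: `|F(u·J + 𝒟₁) − F(u·J + 𝒟₂)| ≤ 36·max|𝒟₁ − 𝒟₂|` entrywise, uniformly in `u·Z`.  0 kit.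
-/

noncomputable section

namespace Summit.HubbardSuperconductivity.HubbardSuperconductivity.Theorems.KLProgrammeCooperResummation

set_option linter.dupNamespace false -- summit = problem name (single-conjunct summit), D-0017

open scoped Matrix.Norms.Operator
open Matrix Finset

variable {S : Type*} [Fintype S] [DecidableEq S] [Nonempty S]

set_option maxHeartbeats 400000 in
/-- **Sherman–Morrison STRUCTURE with complex rungs and a signed-mass allowance.**  For `z : S → ℂ` with `Z = Σ‖z‖`, `u ≥ 0`, `|𝒟| ≤ δ`
entrywise, `Z·δ ≤ 1/3` and `u·(Z − Re Σ z) ≤ 1/4`: `T = 1 + (u·J + 𝒟)·diag z` is invertible, every ROW sum of `T⁻¹` is `≤ 6`, and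
`T⁻¹·(u·J + 𝒟) = c·J + 𝒟″` for one complex running value `c` with `‖c‖ ≤ (4/3)·u`, `‖c‖·Z ≤ 2` and `|𝒟″(s,t)| ≤ 9·δ` — uniformly in `u·Z`. -/
theorem klcrc_structure (z : S → ℂ) {u δ : ℝ} (hu : 0 ≤ u) (hδ : 0 ≤ δ)
    (𝒟 : Matrix S S ℂ) (h𝒟 : ∀ s t, ‖𝒟 s t‖ ≤ δ) (hθ : (∑ s, ‖z s‖) * δ ≤ 1 / 3)
    (h𝔑 : u * ((∑ s, ‖z s‖) - (∑ s, z s).re) ≤ 1 / 4) :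
    IsUnit (1 + (Matrix.of (fun _ _ : S => (u : ℂ)) + 𝒟) * Matrix.diagonal z) ∧
    (∀ s, ∑ p, ‖((1 + (Matrix.of (fun _ _ : S => (u : ℂ)) + 𝒟) * Matrix.diagonal z)⁻¹) s p‖ ≤ 6) ∧
    ∃ c : ℂ, ‖c‖ ≤ 4 / 3 * u ∧ ‖c‖ * ∑ s, ‖z s‖ ≤ 2 ∧
      ∀ s t : S,
        ‖((1 + (Matrix.of (fun _ _ : S => (u : ℂ)) + 𝒟) * Matrix.diagonal z)⁻¹ * (Matrix.of (fun _ _ : S => (u : ℂ)) + 𝒟)) s t - c‖ ≤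
          9 * δ := by
  -- notation
  set Z : ℝ := ∑ s, ‖z s‖ with hZ_def
  have hZ : 0 ≤ Z := sum_nonneg fun s _ => norm_nonneg _
  set one : S → ℂ := fun _ => (1 : ℂ) with hone_def
  set Dz : Matrix S S ℂ := Matrix.diagonal z with hDz_def
  set J : Matrix S S ℂ := Matrix.of (fun _ _ : S => (u : ℂ)) with hJ_def
  set 𝒞 : Matrix S S ℂ := J + 𝒟 with h𝒞_def
  set X : Matrix S S ℂ := 𝒟 * Dz with hX_def
  have hθ' : Z * δ ≤ 1 / 3 := hθ
  -- Neumann for `X = 𝒟·diag z`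
  have hXn' : ‖X‖ ≤ Z * δ := by
    have := klcrs_norm_mul_diagonal_le z hδ 𝒟 h𝒟
    rw [mul_comm] at this
    exact this
  have hXn : ‖X‖ ≤ 1 / 3 := hXn'.trans hθ'
  obtain ⟨N, hN1, hN2, hNn, hNm1⟩ := klcrf_neumann_sharp X hXn
  have hNm1' : ‖N - 1‖ ≤ 3 / 2 * (Z * δ) := hNm1.trans (by nlinarith [norm_nonneg X])
  have hNm1'' : ‖N - 1‖ ≤ 1 / 2 := hNm1.trans (by nlinarith [norm_nonneg X])
  -- `J * Dz = u |𝟙⟩⟨z|` and `T = (1 + X) + u |𝟙⟩⟨z|`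
  have hJDz : J * Dz = (u : ℂ) • Matrix.vecMulVec one z := by
    ext s t
    simp [hJ_def, hDz_def, Matrix.mul_diagonal, Matrix.vecMulVec_apply, hone_def]
  set T : Matrix S S ℂ := 1 + 𝒞 * Dz with hT_def
  have hT : T = (1 + X) + (u : ℂ) • Matrix.vecMulVec one z := by
    simp only [hT_def, h𝒞_def, hX_def, add_mul, hJDz]
    abel
  -- Sherman–Morrison data
  set m : S → ℂ := N *ᵥ one with hm_def
  have hm1 : ∀ s, ‖m s - 1‖ ≤ 3 / 2 * (Z * δ) := by
    intro s
    have hsplit : m s - 1 = ((N - 1) *ᵥ one) s := by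
      simp only [hm_def, Matrix.sub_mulVec, Matrix.one_mulVec, Pi.sub_apply, hone_def]
    rw [hsplit]
    exact (klcr_mulVec_entry_le (N - 1) one zero_le_one (fun k => by simp [hone_def]) s).trans (by linarith)
  have hm1' : ∀ s, ‖m s - 1‖ ≤ 1 / 2 := fun s => (hm1 s).trans (by nlinarith)
  have hm_bound : ∀ s, ‖m s‖ ≤ 3 / 2 := by
    intro s
    calc ‖m s‖ = ‖(m s - 1) + 1‖ := by rw [sub_add_cancel]
      _ ≤ ‖m s - 1‖ + ‖(1 : ℂ)‖ := norm_add_le _ _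
      _ ≤ 3 / 2 := by rw [norm_one]; linarith [hm1' s]
  set a : S → ℂ := (u : ℂ) • m with ha_def
  have ha_bound : ∀ s, ‖a s‖ ≤ u * (3 / 2) := by
    intro s
    simp only [ha_def, Pi.smul_apply, smul_eq_mul, norm_mul, Complex.norm_real, Real.norm_eq_abs, abs_of_nonneg hu]
    exact mul_le_mul_of_nonneg_left (hm_bound s) hu
  set d : ℂ := 1 + z ⬝ᵥ a with hd_def
  -- `d = 1 + u Σz + u⟨z, m - 1⟩`
  have hd_split : d = 1 + (u : ℂ) * (∑ s, z s) + (u : ℂ) * ∑ s, z s * (m s - 1) := by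
    simp only [hd_def, dotProduct, ha_def, Pi.smul_apply, smul_eq_mul]
    rw [Finset.mul_sum, Finset.mul_sum, add_assoc, ← Finset.sum_add_distrib]
    congr 1
    exact sum_congr rfl fun s _ => by ring
  have hzm : ‖∑ s, z s * (m s - 1)‖ ≤ Z * (1 / 2) := by
    calc ‖∑ s, z s * (m s - 1)‖ ≤ ∑ s, ‖z s * (m s - 1)‖ := norm_sum_le _ _
      _ ≤ ∑ s, ‖z s‖ * (1 / 2) := sum_le_sum fun s _ => by
          rw [norm_mul]
          exact mul_le_mul_of_nonneg_left (hm1' s) (norm_nonneg _)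
      _ = Z * (1 / 2) := by rw [← Finset.sum_mul]
  have hd_re : 3 / 4 + u * Z / 2 ≤ d.re := by
    rw [hd_split, Complex.add_re, Complex.add_re, Complex.one_re]
    have h1 : ((u : ℂ) * ∑ s, z s).re = u * (∑ s, z s).re := by simp [Complex.mul_re]
    have h2 : -(u * (Z * (1 / 2))) ≤ ((u : ℂ) * ∑ s, z s * (m s - 1)).re := by
      have hre := Complex.abs_re_le_norm ((u : ℂ) * ∑ s, z s * (m s - 1))
      rw [norm_mul, Complex.norm_real, Real.norm_eq_abs, abs_of_nonneg hu] at hre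
      have := mul_le_mul_of_nonneg_left hzm hu
      rw [abs_le] at hre
      linarith [hre.1]
    rw [h1]
    have h3 : u * Z - 1 / 4 ≤ u * (∑ s, z s).re := by
      have : u * (∑ s, z s).re = u * Z - u * (Z - (∑ s, z s).re) := by ring
      rw [this]; linarith
    linarith
  have hd_norm : 3 / 4 + u * Z / 2 ≤ ‖d‖ := hd_re.trans (Complex.re_le_norm d)
  have hd_pos : 0 < ‖d‖ := lt_of_lt_of_le (by nlinarith [mul_nonneg hu hZ]) hd_norm
  have hd_ne : d ≠ 0 := norm_pos_iff.mp hd_pos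
  -- the right inverse `R = (1 - d⁻¹ |a⟩⟨z|) N`
  set V : Matrix S S ℂ := Matrix.vecMulVec a z with hV_def
  set R : Matrix S S ℂ := (1 - d⁻¹ • V) * N with hR_def
  have hNa : (1 + X) *ᵥ a = (u : ℂ) • one := by
    simp only [ha_def, Matrix.mulVec_smul, hm_def, Matrix.mulVec_mulVec, hN1, Matrix.one_mulVec]
  have hfac : T = (1 + X) * (1 + V) := by
    rw [mul_add, mul_one, hV_def, Matrix.mul_vecMulVec, hNa, hT]
    congr 1
    ext s t
    simp [Matrix.vecMulVec_apply, hone_def]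
  have hVV : V * V = (z ⬝ᵥ a) • V := by
    rw [hV_def, Matrix.vecMulVec_mul_vecMulVec, Matrix.vecMulVec_smul]
  have hSM : (1 + V) * (1 - d⁻¹ • V) = 1 := by
    calc (1 + V) * (1 - d⁻¹ • V) = (1 + V) - d⁻¹ • ((1 + V) * V) := by rw [mul_sub, mul_one, mul_smul_comm]
      _ = (1 + V) - d⁻¹ • ((1 + z ⬝ᵥ a) • V) := by rw [add_mul, one_mul, hVV, add_smul, one_smul]
      _ = (1 + V) - (d⁻¹ * d) • V := by rw [smul_smul, hd_def]
      _ = 1 := by rw [inv_mul_cancel₀ hd_ne, one_smul, add_sub_cancel_right]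
  have hTR : T * R = 1 := by
    rw [hfac, hR_def, ← mul_assoc, mul_assoc (1 + X), hSM, mul_one, hN1]
  have hTunit : IsUnit T := by
    rw [Matrix.isUnit_iff_isUnit_det]
    exact Matrix.isUnit_det_of_right_inverse hTR
  have hTinv : T⁻¹ = R := Matrix.inv_eq_right_inv hTR
  -- row sums of `N`; the key ratio `uZ/‖d‖ ≤ 2`
  have hNrow : ∀ s, ∑ p, ‖N s p‖ ≤ 3 / 2 := fun s => (klcr_row_sum_le_norm N s).trans hNn
  have hkey : ‖d‖⁻¹ * (u * Z) ≤ 2 := by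
    rw [inv_mul_le_iff₀ hd_pos]; nlinarith [hd_norm, mul_nonneg hu hZ]
  refine ⟨hTunit, ?_, ?_⟩
  · -- row sums of `T⁻¹ = N - d⁻¹ |a⟩ (⟨z| N)`
    intro s
    have hRs : ∀ p, R s p = N s p - d⁻¹ * (a s * (z ᵥ* N) p) := by
      intro p
      simp only [hR_def, sub_mul, one_mul, Matrix.smul_mul, hV_def, Matrix.vecMulVec_mul, Matrix.sub_apply,
        Matrix.smul_apply, Matrix.vecMulVec_apply, smul_eq_mul]
    have hzN : ∀ p, ‖(z ᵥ* N) p‖ ≤ ∑ q, ‖z q‖ * ‖N q p‖ := by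
      intro p
      rw [Matrix.vecMul, dotProduct]
      refine (norm_sum_le _ _).trans (le_of_eq (sum_congr rfl fun q _ => ?_))
      rw [norm_mul]
    rw [hTinv]
    calc ∑ p, ‖R s p‖ = ∑ p, ‖N s p - d⁻¹ * (a s * (z ᵥ* N) p)‖ := sum_congr rfl fun p _ => by rw [hRs p]
      _ ≤ ∑ p, (‖N s p‖ + ‖d‖⁻¹ * (‖a s‖ * ‖(z ᵥ* N) p‖)) := sum_le_sum fun p _ => by
          refine (norm_sub_le _ _).trans (add_le_add le_rfl ?_)
          rw [norm_mul, norm_mul, norm_inv]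
      _ = ∑ p, ‖N s p‖ + ‖d‖⁻¹ * ‖a s‖ * ∑ p, ‖(z ᵥ* N) p‖ := by
          rw [sum_add_distrib, Finset.mul_sum]; congr 1; exact sum_congr rfl fun p _ => by ring
      _ ≤ 3 / 2 + ‖d‖⁻¹ * ‖a s‖ * ∑ p, ∑ q, ‖z q‖ * ‖N q p‖ := by
          refine add_le_add (hNrow s) (mul_le_mul_of_nonneg_left (sum_le_sum fun p _ => hzN p) ?_)
          exact mul_nonneg (inv_nonneg.mpr (norm_nonneg _)) (norm_nonneg _)
      _ = 3 / 2 + ‖d‖⁻¹ * ‖a s‖ * ∑ q, ‖z q‖ * ∑ p, ‖N q p‖ := by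
          congr 1; congr 1; rw [Finset.sum_comm]; exact sum_congr rfl fun q _ => by rw [Finset.mul_sum]
      _ ≤ 3 / 2 + ‖d‖⁻¹ * ‖a s‖ * (Z * (3 / 2)) := by
          refine add_le_add le_rfl (mul_le_mul_of_nonneg_left ?_ ?_)
          · calc ∑ q, ‖z q‖ * ∑ p, ‖N q p‖ ≤ ∑ q, ‖z q‖ * (3 / 2) :=
                  sum_le_sum fun q _ => mul_le_mul_of_nonneg_left (hNrow q) (norm_nonneg _)
              _ = Z * (3 / 2) := by rw [← Finset.sum_mul]
          · exact mul_nonneg (inv_nonneg.mpr (norm_nonneg _)) (norm_nonneg _)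
      _ ≤ 3 / 2 + 9 / 2 := by
          refine add_le_add le_rfl ?_
          calc ‖d‖⁻¹ * ‖a s‖ * (Z * (3 / 2)) ≤ ‖d‖⁻¹ * (u * (3 / 2)) * (Z * (3 / 2)) := by
                gcongr; exact ha_bound s
            _ = (‖d‖⁻¹ * (u * Z)) * (9 / 4) := by ring
            _ ≤ 2 * (9 / 4) := by gcongr
            _ = 9 / 2 := by norm_num
      _ = 6 := by norm_num
  · -- structure: `T⁻¹ 𝒞 = (u/d) |m⟩⟨𝟙| + (N 𝒟 - d⁻¹ |a⟩⟨z| N 𝒟)`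
    refine ⟨(u : ℂ) / d, ?_, ?_, fun s t => ?_⟩
    · rw [norm_div, Complex.norm_real, Real.norm_eq_abs, abs_of_nonneg hu, div_le_iff₀ hd_pos]
      nlinarith [hd_norm, mul_nonneg hu hZ]
    · rw [norm_div, Complex.norm_real, Real.norm_eq_abs, abs_of_nonneg hu, div_mul_eq_mul_div, div_le_iff₀ hd_pos]
      nlinarith [hd_norm, mul_nonneg hu hZ]
    have hNC : T⁻¹ * 𝒞 = N * 𝒞 - d⁻¹ • Matrix.vecMulVec a (z ᵥ* (N * 𝒞)) := by
      rw [hTinv, hR_def, mul_assoc, sub_mul, one_mul, Matrix.smul_mul, hV_def, Matrix.vecMulVec_mul]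
    -- `N * J = u |m⟩⟨𝟙|`, `⟨z| (N J) = u ⟨z,m⟩ ⟨𝟙|`
    have hNJ : ∀ p q, (N * J) p q = (u : ℂ) * m p := by
      intro p q
      simp only [Matrix.mul_apply, hJ_def, Matrix.of_apply, hm_def, Matrix.mulVec, dotProduct, hone_def, mul_one]
      rw [← Finset.sum_mul, mul_comm]
    have hzNJ : ∀ q, (z ᵥ* (N * J)) q = (u : ℂ) * (z ⬝ᵥ m) := by
      intro q
      simp only [Matrix.vecMul, dotProduct, hNJ]
      rw [Finset.mul_sum]
      exact sum_congr rfl fun p _ => by ring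
    have hdm : d = 1 + (u : ℂ) * (z ⬝ᵥ m) := by
      simp only [hd_def, dotProduct, ha_def, Pi.smul_apply, smul_eq_mul, Finset.mul_sum]
      congr 1; exact sum_congr rfl fun p _ => by ring
    -- the entry, split into the s-wave part and the rest
    have hentry : (T⁻¹ * 𝒞) s t = (u : ℂ) / d * m s +
        ((N * 𝒟) s t - d⁻¹ * (a s * (z ᵥ* (N * 𝒟)) t)) := by
      rw [hNC]
      simp only [Matrix.sub_apply, Matrix.smul_apply, Matrix.vecMulVec_apply, smul_eq_mul, h𝒞_def, mul_add,
        Matrix.add_apply, Matrix.vecMul_add, Pi.add_apply, hNJ, hzNJ]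
      simp only [ha_def, Pi.smul_apply, smul_eq_mul]
      have hd1 : d⁻¹ * ((u : ℂ) * (z ⬝ᵥ m)) = 1 - d⁻¹ := by
        have : (u : ℂ) * (z ⬝ᵥ m) = d - 1 := by rw [hdm]; ring
        rw [this, mul_sub, inv_mul_cancel₀ hd_ne, mul_one]
      have key : (u : ℂ) * m s - d⁻¹ * ((u : ℂ) * m s * ((u : ℂ) * (z ⬝ᵥ m))) = (u : ℂ) / d * m s := by
        have : d⁻¹ * ((u : ℂ) * m s * ((u : ℂ) * (z ⬝ᵥ m))) = (u : ℂ) * m s * (d⁻¹ * ((u : ℂ) * (z ⬝ᵥ m))) := by ring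
        rw [this, hd1]
        field_simp
        ring
      rw [← key]
      ring
    -- bounds on the pieces
    have hP1 : ‖(N * 𝒟) s t‖ ≤ 3 / 2 * δ :=
      (klcr_mul_entry_le N 𝒟 hδ t (fun k => h𝒟 k t) s).trans (mul_le_mul_of_nonneg_right hNn hδ)
    have hzND : ‖(z ᵥ* (N * 𝒟)) t‖ ≤ Z * (3 / 2 * δ) :=
      klcr_vecMul_entry_le z (N * 𝒟) t (fun q =>
        (klcr_mul_entry_le N 𝒟 hδ t (fun k => h𝒟 k t) q).trans (mul_le_mul_of_nonneg_right hNn hδ))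
    have hP2 : ‖d⁻¹ * (a s * (z ᵥ* (N * 𝒟)) t)‖ ≤ 9 / 2 * δ := by
      rw [norm_mul, norm_mul, norm_inv]
      calc ‖d‖⁻¹ * (‖a s‖ * ‖(z ᵥ* (N * 𝒟)) t‖) ≤ ‖d‖⁻¹ * ((u * (3 / 2)) * (Z * (3 / 2 * δ))) :=
            mul_le_mul_of_nonneg_left (mul_le_mul (ha_bound s) hzND (norm_nonneg _) (by positivity))
              (inv_nonneg.mpr (norm_nonneg _))
        _ = (‖d‖⁻¹ * (u * Z)) * (9 / 4 * δ) := by ring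
        _ ≤ 2 * (9 / 4 * δ) := mul_le_mul_of_nonneg_right hkey (by positivity)
        _ = 9 / 2 * δ := by ring
    -- the s-wave piece against `u/d`
    have hP3 : ‖(u : ℂ) / d * m s - (u : ℂ) / d‖ ≤ 3 * δ := by
      have h3δ : (0 : ℝ) ≤ 3 * δ := by linarith [hδ]
      have : (u : ℂ) / d * m s - (u : ℂ) / d = (u : ℂ) / d * (m s - 1) := by ring
      rw [this, norm_mul, norm_div, Complex.norm_real, Real.norm_eq_abs, abs_of_nonneg hu, div_mul_eq_mul_div,
        div_le_iff₀ hd_pos]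
      have h3 : 3 * δ * (3 / 4 + u * Z / 2) ≤ 3 * δ * ‖d‖ := mul_le_mul_of_nonneg_left hd_norm h3δ
      have h4 : u * (3 / 2 * (Z * δ)) ≤ 3 * δ * (3 / 4 + u * Z / 2) := by
        have : 3 * δ * (3 / 4 + u * Z / 2) - u * (3 / 2 * (Z * δ)) = 9 / 4 * δ := by ring
        linarith
      exact (mul_le_mul_of_nonneg_left (hm1 s) hu).trans (h4.trans h3)
    rw [hentry]
    have hre : (u : ℂ) / d * m s + ((N * 𝒟) s t - d⁻¹ * (a s * (z ᵥ* (N * 𝒟)) t)) - (u : ℂ) / d =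
        ((u : ℂ) / d * m s - (u : ℂ) / d) + ((N * 𝒟) s t - d⁻¹ * (a s * (z ᵥ* (N * 𝒟)) t)) := by ring
    rw [hre]
    calc ‖((u : ℂ) / d * m s - (u : ℂ) / d) + ((N * 𝒟) s t - d⁻¹ * (a s * (z ᵥ* (N * 𝒟)) t))‖
        ≤ ‖(u : ℂ) / d * m s - (u : ℂ) / d‖ + ‖(N * 𝒟) s t - d⁻¹ * (a s * (z ᵥ* (N * 𝒟)) t)‖ := norm_add_le _ _
      _ ≤ 3 * δ + (3 / 2 * δ + 9 / 2 * δ) := add_le_add hP3 ((norm_sub_le _ _).trans (add_le_add hP1 hP2))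
      _ = 9 * δ := by ring

/-- **Entry bound of the resummed array**: `|F(s,t)| ≤ (4/3)·u + 9·δ`. -/
theorem klcrc_entry_le (z : S → ℂ) {u δ : ℝ} (hu : 0 ≤ u) (hδ : 0 ≤ δ)
    (𝒟 : Matrix S S ℂ) (h𝒟 : ∀ s t, ‖𝒟 s t‖ ≤ δ) (hθ : (∑ s, ‖z s‖) * δ ≤ 1 / 3)
    (h𝔑 : u * ((∑ s, ‖z s‖) - (∑ s, z s).re) ≤ 1 / 4) (s t : S) :
    ‖((1 + (Matrix.of (fun _ _ : S => (u : ℂ)) + 𝒟) * Matrix.diagonal z)⁻¹ * (Matrix.of (fun _ _ : S => (u : ℂ)) + 𝒟)) s t‖ ≤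
      4 / 3 * u + 9 * δ := by
  obtain ⟨-, -, c, hc, -, hF⟩ := klcrc_structure z hu hδ 𝒟 h𝒟 hθ h𝔑
  have h := hF s t
  calc _ = ‖(((1 + (Matrix.of (fun _ _ : S => (u : ℂ)) + 𝒟) * Matrix.diagonal z)⁻¹ *
              (Matrix.of (fun _ _ : S => (u : ℂ)) + 𝒟)) s t - c) + c‖ := by rw [sub_add_cancel]
    _ ≤ _ := norm_add_le _ _
    _ ≤ 9 * δ + 4 / 3 * u := add_le_add h hc
    _ = 4 / 3 * u + 9 * δ := by ring

/-- **Row mass of the resummed array against the rungs**: `Σ_a |F(x,a)|·‖z_a‖ ≤ 5` (`= ‖c‖·Z + 9δ·Z ≤ 2 + 3`), uniformly in `u·Z`. -/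
theorem klcrc_rowMass_le (z : S → ℂ) {u δ : ℝ} (hu : 0 ≤ u) (hδ : 0 ≤ δ)
    (𝒟 : Matrix S S ℂ) (h𝒟 : ∀ s t, ‖𝒟 s t‖ ≤ δ) (hθ : (∑ s, ‖z s‖) * δ ≤ 1 / 3)
    (h𝔑 : u * ((∑ s, ‖z s‖) - (∑ s, z s).re) ≤ 1 / 4) (x : S) :
    ∑ a, ‖((1 + (Matrix.of (fun _ _ : S => (u : ℂ)) + 𝒟) * Matrix.diagonal z)⁻¹ * (Matrix.of (fun _ _ : S => (u : ℂ)) + 𝒟)) x a‖ *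
        ‖z a‖ ≤ 5 := by
  obtain ⟨-, -, c, -, hcZ, hF⟩ := klcrc_structure z hu hδ 𝒟 h𝒟 hθ h𝔑
  set F := (1 + (Matrix.of (fun _ _ : S => (u : ℂ)) + 𝒟) * Matrix.diagonal z)⁻¹ * (Matrix.of (fun _ _ : S => (u : ℂ)) + 𝒟) with hF_def
  have hZ : 0 ≤ ∑ s, ‖z s‖ := sum_nonneg fun s _ => norm_nonneg _
  have hent : ∀ a, ‖F x a‖ ≤ ‖c‖ + 9 * δ := by
    intro a
    calc ‖F x a‖ = ‖(F x a - c) + c‖ := by rw [sub_add_cancel]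
      _ ≤ ‖F x a - c‖ + ‖c‖ := norm_add_le _ _
      _ ≤ 9 * δ + ‖c‖ := add_le_add (hF x a) le_rfl
      _ = ‖c‖ + 9 * δ := by ring
  calc ∑ a, ‖F x a‖ * ‖z a‖ ≤ ∑ a, (‖c‖ + 9 * δ) * ‖z a‖ :=
        sum_le_sum fun a _ => mul_le_mul_of_nonneg_right (hent a) (norm_nonneg _)
    _ = ‖c‖ * ∑ s, ‖z s‖ + 9 * ((∑ s, ‖z s‖) * δ) := by rw [← Finset.mul_sum]; ring
    _ ≤ 2 + 9 * (1 / 3) := add_le_add hcZ (by nlinarith)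
    _ = 5 := by norm_num

/-- **Weighted column mass of the resummed array**: `Σ_b ‖z_b‖·|F(b,y)| ≤ 5`, uniformly in `u·Z`. -/
theorem klcrc_colMass_le (z : S → ℂ) {u δ : ℝ} (hu : 0 ≤ u) (hδ : 0 ≤ δ)
    (𝒟 : Matrix S S ℂ) (h𝒟 : ∀ s t, ‖𝒟 s t‖ ≤ δ) (hθ : (∑ s, ‖z s‖) * δ ≤ 1 / 3)
    (h𝔑 : u * ((∑ s, ‖z s‖) - (∑ s, z s).re) ≤ 1 / 4) (y : S) :
    ∑ b, ‖z b‖ * ‖((1 + (Matrix.of (fun _ _ : S => (u : ℂ)) + 𝒟) * Matrix.diagonal z)⁻¹ *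
        (Matrix.of (fun _ _ : S => (u : ℂ)) + 𝒟)) b y‖ ≤ 5 := by
  obtain ⟨-, -, c, -, hcZ, hF⟩ := klcrc_structure z hu hδ 𝒟 h𝒟 hθ h𝔑
  set F := (1 + (Matrix.of (fun _ _ : S => (u : ℂ)) + 𝒟) * Matrix.diagonal z)⁻¹ * (Matrix.of (fun _ _ : S => (u : ℂ)) + 𝒟) with hF_def
  have hZ : 0 ≤ ∑ s, ‖z s‖ := sum_nonneg fun s _ => norm_nonneg _
  have hent : ∀ b, ‖F b y‖ ≤ ‖c‖ + 9 * δ := by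
    intro b
    calc ‖F b y‖ = ‖(F b y - c) + c‖ := by rw [sub_add_cancel]
      _ ≤ ‖F b y - c‖ + ‖c‖ := norm_add_le _ _
      _ ≤ 9 * δ + ‖c‖ := add_le_add (hF b y) le_rfl
      _ = ‖c‖ + 9 * δ := by ring
  calc ∑ b, ‖z b‖ * ‖F b y‖ ≤ ∑ b, ‖z b‖ * (‖c‖ + 9 * δ) :=
        sum_le_sum fun b _ => mul_le_mul_of_nonneg_left (hent b) (norm_nonneg _)
    _ = ‖c‖ * ∑ s, ‖z s‖ + 9 * ((∑ s, ‖z s‖) * δ) := by rw [← Finset.sum_mul]; ring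
    _ ≤ 2 + 9 * (1 / 3) := add_le_add hcZ (by nlinarith)
    _ = 5 := by norm_num

set_option maxHeartbeats 400000 in
/-- **Lipschitz continuity with complex rungs of large mass, constant `36`.**  For `z`, `u`, `δ` as in `klcrc_structure` and two second-order
parts `|𝒟₁|, |𝒟₂| ≤ δ` with `|𝒟₁ − 𝒟₂| ≤ Δ` entrywise: every entry of `F(u·J + 𝒟₁) − F(u·J + 𝒟₂)` (`F(X) = (1 + X·diag z)⁻¹·X`) is at most
`36·Δ` — NO amplification by the accumulated mass `1 + u·Z ≍ c/U`.  (Resolvent identity `klcrf_resolvent_identity`; row sums of the left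
resolvent `≤ 6`; weighted column mass of the right resummed array `≤ 5`.) -/
theorem klcrc_lipschitz (z : S → ℂ) {u δ Δ : ℝ} (hu : 0 ≤ u) (hδ : 0 ≤ δ) (hΔ : 0 ≤ Δ)
    (𝒟₁ 𝒟₂ : Matrix S S ℂ) (h𝒟₁ : ∀ s t, ‖𝒟₁ s t‖ ≤ δ) (h𝒟₂ : ∀ s t, ‖𝒟₂ s t‖ ≤ δ) (hE : ∀ s t, ‖(𝒟₁ - 𝒟₂) s t‖ ≤ Δ)
    (hθ : (∑ s, ‖z s‖) * δ ≤ 1 / 3) (h𝔑 : u * ((∑ s, ‖z s‖) - (∑ s, z s).re) ≤ 1 / 4) (x y : S) :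
    ‖((1 + (Matrix.of (fun _ _ : S => (u : ℂ)) + 𝒟₁) * Matrix.diagonal z)⁻¹ * (Matrix.of (fun _ _ : S => (u : ℂ)) + 𝒟₁) -
        (1 + (Matrix.of (fun _ _ : S => (u : ℂ)) + 𝒟₂) * Matrix.diagonal z)⁻¹ * (Matrix.of (fun _ _ : S => (u : ℂ)) + 𝒟₂)) x y‖ ≤
      36 * Δ := by
  set D : Matrix S S ℂ := Matrix.diagonal z with hD_def
  set J : Matrix S S ℂ := Matrix.of (fun _ _ : S => (u : ℂ)) with hJ_def
  set X₁ : Matrix S S ℂ := J + 𝒟₁ with hX₁_def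
  set X₂ : Matrix S S ℂ := J + 𝒟₂ with hX₂_def
  obtain ⟨hU₁, hrow₁, -⟩ := klcrc_structure z hu hδ 𝒟₁ h𝒟₁ hθ h𝔑
  obtain ⟨hU₂, -, -⟩ := klcrc_structure z hu hδ 𝒟₂ h𝒟₂ hθ h𝔑
  have hcol₂ := klcrc_colMass_le z hu hδ 𝒟₂ h𝒟₂ hθ h𝔑 y
  set F₂ : Matrix S S ℂ := (1 + X₂ * D)⁻¹ * X₂ with hF₂_def
  have hid := klcrf_resolvent_identity X₁ X₂ D hU₁ hU₂
  have hX : X₁ - X₂ = 𝒟₁ - 𝒟₂ := by rw [hX₁_def, hX₂_def]; abel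
  rw [hid, hX]
  -- entry of the sandwich `T₁⁻¹ · E · (1 - D·F₂)`
  set P : Matrix S S ℂ := (1 + X₁ * D)⁻¹ with hP_def
  set E : Matrix S S ℂ := 𝒟₁ - 𝒟₂ with hE_def
  have hinner : ∀ a, ‖(E * (1 - D * F₂)) a y‖ ≤ Δ * 6 := by
    intro a
    have hsplit : (E * (1 - D * F₂)) a y = E a y - ∑ b, E a b * (z b * F₂ b y) := by
      rw [mul_sub, mul_one, Matrix.sub_apply, Matrix.mul_apply]
      congr 1
      refine sum_congr rfl fun b _ => ?_
      rw [hD_def, Matrix.diagonal_mul]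
    rw [hsplit]
    calc ‖E a y - ∑ b, E a b * (z b * F₂ b y)‖ ≤ ‖E a y‖ + ‖∑ b, E a b * (z b * F₂ b y)‖ := norm_sub_le _ _
      _ ≤ Δ + ∑ b, ‖E a b * (z b * F₂ b y)‖ := add_le_add (hE a y) (norm_sum_le _ _)
      _ ≤ Δ + ∑ b, Δ * (‖z b‖ * ‖F₂ b y‖) := by
          refine add_le_add le_rfl (sum_le_sum fun b _ => ?_)
          rw [norm_mul, norm_mul]
          exact mul_le_mul_of_nonneg_right (hE a b) (mul_nonneg (norm_nonneg _) (norm_nonneg _))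
      _ = Δ + Δ * ∑ b, ‖z b‖ * ‖F₂ b y‖ := by rw [← Finset.mul_sum]
      _ ≤ Δ + Δ * 5 := add_le_add le_rfl (mul_le_mul_of_nonneg_left hcol₂ hΔ)
      _ = Δ * 6 := by ring
  rw [mul_assoc, Matrix.mul_apply]
  calc ‖∑ a, P x a * (E * (1 - D * F₂)) a y‖ ≤ ∑ a, ‖P x a * (E * (1 - D * F₂)) a y‖ := norm_sum_le _ _
    _ ≤ ∑ a, ‖P x a‖ * (Δ * 6) := sum_le_sum fun a _ => by
        rw [norm_mul]; exact mul_le_mul_of_nonneg_left (hinner a) (norm_nonneg _)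
    _ = (∑ a, ‖P x a‖) * (Δ * 6) := by rw [Finset.sum_mul]
    _ ≤ 6 * (Δ * 6) := mul_le_mul_of_nonneg_right (hrow₁ x) (by positivity)
    _ = 36 * Δ := by ring

end Summit.HubbardSuperconductivity.HubbardSuperconductivity.Theorems.KLProgrammeCooperResummation

end
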